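import Literature.Computability.MetaComplexity.DirectProductGenerator
import Literature.Computability.Cryptography.GoldreichLevinInverter
import HarnessLib

/-!
# Complexity meta: one run of the randomised reconstruction for `DP_k` (Hirahara 2021, Lemma 3.11 / Thm. 3.12), via Goldreich–Levin

Topic `Literature/Computability/MetaComplexity`, companion to `DirectProductGenerator.lean` (Def. 3.9 /
3.10: `hadBit`, `dpGen`, `dpAdvantage`, `dpEnumEnc`) for S. Hirahara, *Average-case hardness of NP from
exponential worst-case hardness assumptions*, STOC 2021 (ECCC TR21-058, numbering cited). The paper's
Thm. 3.12 (reconstruction for the `k`-wise direct product generator `DP_k(x; z) = (z, Had(x)(z₁), …,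
Had(x)(z_k))`) rests on Lemma 3.11 (Goldreich–Levin local list decoding of the Hadamard code) and a
distinguisher-to-predictor step. This file formalises ONE RUN of the randomised reconstruction and its
success probability, reusing the tree's Goldreich–Levin theorem for hiding functions
(`Cryptography/GoldreichLevin*.lean`, whose samples `σ ‖ GL(x, σ)` ARE `DP_K(x; σ)`):

* `DPRecon.testAlg D₀`, `DPRecon.hdr a` — the test `w ↦ [⟨a, w⟩ ∈ D₀]` (a polynomial-time language with
  auxiliary input `a`, the tests of Claim 8.11) dressed as a coinless `RandAlg` on the input format
  `⟨1ⁿ, hdr a ++ w⟩` of the string predictor `GLDec.predStr` (`hdr a ++ w = ⟨a, w⟩`);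
* `DPRecon.gap_ge` — a test that `δ`-distinguishes `DP_K(x; ·)` from uniform (`dpAdvantage ≥ δ`) has, for
  the right sign, the signed gap `2^K·Re − Id ≥ δ·2^{Kn}·2^K` required by the math layer
  `GLPred.inverter_count` (XOR lemma + Rackoff's decoder; `X = R = Unit`, no coins);
* `DPRecon.run D₀ a n K kk c` — one run on coins `c = sgn ‖ mask_J ‖ β ‖ ω' ‖ v ‖ seeds ‖ τ`: Rackoff's
  candidate for the predictor of `⟨x, r⟩` built from the sign-adjusted test (parity set `J`, embedded
  query), with `K = k` hard-core bits and `kk` seeds as free parameters; `run_split`, `card_success_ge`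
  (the coin strings re-indexed by the objects of the math layer, as in `GoldreichLevinInverter.lean`);
* `DPRecon.uniformProb_run_eq_ge` — **one run outputs `x` with probability `≥ δ/(4·2^K·2^kk)`** whenever
  `n ≤ 2(δ/2^{K+1})²(2^kk − 1)` (Lemma 3.11's "outputs `x` with probability at least `1/poly(n/ε)`",
  with the `2^{-K}` of the XOR lemma and the `2^{-kk}` of the random guess explicit).

The polynomial-time program computing `run` from `⟨⟨a, 1ⁿ, 1^{2^k}, 1ᵉ⟩, c⟩`, the choice of `kk`, and the
enumeration form of Thm. 3.12 under `PromiseBPP' ⊆ PromiseP` are in `DPReconstruction.lean`.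

## Remark on the route

The paper's Lemma 3.14 uses the hybrid argument with a `k`-bit advice string; here the advice-free XOR
lemma route of Goldreich 2001, §2.5.2–2.5.3 (already in the tree) is taken, at the price of a factor
`2^{-k}` in the advantage instead of `k` bits of advice — immaterial for the enumeration form, whose time
budget is `poly(n, 2^k, 1/δ)` anyway (it does NOT give the `K`-complexity form `K(x | D) ≤ k + O(log n)`).

## References

* S. Hirahara, ECCC TR21-058 (2021): §3.1 (p. 20), Def. 3.9–3.10, Lemma 3.11, Thm. 3.12 and the remark
  following it, Lemma 3.14 (pp. 22–25).
* O. Goldreich, L. A. Levin, *A hard-core predicate for all one-way functions*, STOC 1989.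
* O. Goldreich, *Foundations of Cryptography I*, CUP 2001, Thm. 2.5.6, §2.5.2 (XOR lemma, the sign of the
  gap), §2.5.3.
* S. Arora, B. Barak, *Computational Complexity: A Modern Approach*, CUP 2009, Thm. 9.12 (Rackoff's proof).
-/

noncomputable section

namespace Literature.Computability.MetaComplexity

open _root_.Computability Complexity Complexity.Stockmeyer Finset Matrix
open Literature.Computability.Cryptography Cryptography.AffineStr Cryptography.GLEns Cryptography.GLDec Cryptography.GLInv

namespace DPRecon

/-- The empty coin vector is the only vector of length `0` (the test of this file uses no coins;
Mathlib records only `Subsingleton (List.Vector α 0)`). [folklore] -/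
instance uniqueVectorZero : Unique (List.Vector Bool 0) where
  default := List.Vector.nil
  uniq v := List.Vector.eq_nil v

/-! ### The test as a (coinless) randomized algorithm on the Goldreich–Levin input format -/

/-- The self-delimiting header of `a`: `boolPair a w = hdr a ++ w`. [folklore] -/
def hdr (a : List Bool) : List Bool := (a.flatMap fun b => [b, b]) ++ [false, true]

/-- `hdr a ++ w = ⟨a, w⟩`. [folklore] -/
theorem hdr_append (a w : List Bool) : hdr a ++ w = boolPair a w := by
  simp [hdr, boolPair, List.append_assoc]

/-- The test `w ↦ [⟨a, w⟩ ∈ D₀]` dressed as a (coinless) randomized algorithm on inputs `⟨1ⁿ, hdr a ++ w⟩`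
(the input format of the tree's Goldreich–Levin string predictor `GLDec.predStr`): strip `1ⁿ`, decide `D₀`.
[folklore] -/
def testAlg (D₀ : Set (List Bool)) : RandAlg (List Bool) Bool where
  run inp _ := D₀.boolIndicator (boolUnpair inp).2
  coinLen _ := 0

/-- On the Goldreich–Levin input format the dressed test is the test. [folklore] -/
@[simp] theorem testAlg_run (D₀ : Set (List Bool)) (n : ℕ) (a w c : List Bool) :
    (testAlg D₀).run (boolPair (unaryEncodeNat n) (hdr a ++ w)) c = D₀.boolIndicator (boolPair a w) := by
  simp [testAlg, hdr_append]

/-! ### The distinguishing gap as a difference of counts -/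

section Counts

variable (D₀ : Set (List Bool)) (a : List Bool) {n : ℕ} (x : List.Vector Bool n) (K : ℕ)

/-- The test on strings. [folklore] -/
def T (w : List Bool) : Bool := D₀.boolIndicator (boolPair a w)

/-- The sign-adjusted test as the `Df` of the math layer (`X = R = Unit`, no coins). [folklore] -/
def Df (sgn : Bool) (_ : Unit) (_ : Unit) (σ : Fin K → BVec n) (u : BVec K) (c : List.Vector Bool 0) : Bool :=
  DfS (testAlg D₀) n K sgn (hdr a) σ u c

/-- `Df` is the sign-adjusted test on `blocks σ ‖ bits u`. [folklore] -/
theorem Df_eq (sgn : Bool) (p q : Unit) (σ : Fin K → BVec n) (u : BVec K) (c : List.Vector Bool 0) :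
    Df D₀ a K sgn p q σ u c = Bool.xor sgn (T D₀ a (blocksStr σ ++ encZ K u)) := by
  simp only [Df, DfS, T, List.append_assoc, testAlg_run]

/-- The real acceptance count `Re = #{σ | T(DP_K(x; blocks σ))}`. [folklore] -/
noncomputable def Re : ℕ := (univ.filter fun σ : Fin K → BVec n => T D₀ a (blocksStr σ ++ encZ K fun j => toZ x ⬝ᵥ σ j) = true).card

/-- The ideal acceptance count `Id = #{(σ, u) | T(blocks σ ‖ bits u)}`. [folklore] -/
noncomputable def Id : ℕ := (univ.filter fun q : (Fin K → BVec n) × BVec K => T D₀ a (blocksStr q.1 ++ encZ K q.2) = true).card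

/-- `DP_K(x; blocks σ) = blocks σ ‖ (⟨x, σ_j⟩)_j`. [folklore] -/
theorem dpGen_blocksStr (σ : Fin K → BVec n) : dpGen K x.toList (blocksStr σ) = blocksStr σ ++ encZ K fun j => toZ x ⬝ᵥ σ j := by
  rw [← glBits_blocksStr x σ]
  simp only [dpGen, List.Vector.toList_length]
  rfl

/-- `Pr_z[T(DP_K(x; z))] · 2^{Kn} = Re`. [folklore] -/
theorem prReal_mul_eq : uniformProb (K * n) {z | T D₀ a (dpGen K x.toList z) = true} * 2 ^ (K * n) = Re D₀ a x K := by
  classical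
  unfold uniformProb Re
  rw [div_mul_cancel₀ _ (by positivity)]
  congr 1
  refine Finset.card_equiv (blocksEquiv n K).symm fun z => ?_
  simp only [mem_filter, mem_univ, true_and, Set.mem_setOf_eq]
  rw [GLInv.toList_eq_blocksStr_symm z, dpGen_blocksStr]

/-- `Pr_w[T(w)] · 2^{Kn} 2^K = Id`. [folklore] -/
theorem prIdeal_mul_eq : uniformProb (K * n + K) {w | T D₀ a w = true} * (2 ^ (K * n) * 2 ^ K) = Id D₀ a K (n := n) := by
  classical
  unfold uniformProb Id
  rw [pow_add, div_mul_cancel₀ _ (by positivity)]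
  have h := Literature.Computability.Cryptography.sum_vector_add (M := ℕ) (K * n) K
    (fun u w => if T D₀ a (u ++ w) = true then 1 else 0)
  simp only [List.take_append_drop] at h
  rw [Finset.natCast_card_filter, Finset.natCast_card_filter]
  have h' : (∑ z : List.Vector Bool (K * n + K), (if T D₀ a z.toList = true then 1 else 0 : ℕ)) =
      ∑ q : (Fin K → BVec n) × BVec K, (if T D₀ a (blocksStr q.1 ++ encZ K q.2) = true then 1 else 0 : ℕ) := by
    rw [h, Fintype.sum_prod_type]
    dsimp only
    rw [GLInv.sum_vector_eq_sum_blocks n K (fun u => ∑ w : List.Vector Bool K, if T D₀ a (u ++ w.toList) = true then 1 else 0)]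
    refine Finset.sum_congr rfl fun σ _ => ?_
    exact GLEns.sum_vector_eq_sum_bvec (M := ℕ) K (fun w => if T D₀ a (blocksStr σ ++ w) = true then 1 else 0)
  exact_mod_cast h'

/-- The real count of the math layer is `Re` (sign `0`) or its complement (sign `1`). [folklore] -/
theorem card_real_sgn (sgn : Bool) :
    ((univ.filter fun q : Unit × Unit × (Fin K → BVec n) × List.Vector Bool 0 =>
        Df D₀ a K sgn q.1 q.2.1 q.2.2.1 (fun j => toZ x ⬝ᵥ q.2.2.1 j) q.2.2.2).card : ℝ) =
      if sgn then (Fintype.card (Fin K → BVec n) : ℝ) - Re D₀ a x K else Re D₀ a x K := by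
  classical
  -- re-index by `σ`
  have hidx : ∀ P : (Fin K → BVec n) → Prop, ∀ [DecidablePred P],
      (univ.filter fun q : Unit × Unit × (Fin K → BVec n) × List.Vector Bool 0 => P q.2.2.1).card = (univ.filter P).card := by
    intro P _
    refine Finset.card_equiv ((Equiv.punitProd _).trans ((Equiv.punitProd _).trans (Equiv.prodUnique _ _))) fun q => ?_
    obtain ⟨_, _, σ, c⟩ := q
    simp [Equiv.punitProd, Equiv.prodUnique]
  simp only [Df_eq]
  rw [hidx fun σ => Bool.xor sgn (T D₀ a (blocksStr σ ++ encZ K fun j => toZ x ⬝ᵥ σ j)) = true]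
  cases sgn
  · simp [Re]
  · simp only [Bool.true_xor, ite_true, Re]
    rw [eq_sub_iff_add_eq]
    have h := Finset.card_filter_add_card_filter_not (s := (univ : Finset (Fin K → BVec n)))
      (fun σ => T D₀ a (blocksStr σ ++ encZ K fun j => toZ x ⬝ᵥ σ j) = true)
    rw [card_univ, add_comm] at h
    have h' : (univ.filter fun σ : Fin K → BVec n => (!T D₀ a (blocksStr σ ++ encZ K fun j => toZ x ⬝ᵥ σ j)) = true) =
        univ.filter fun σ : Fin K → BVec n => ¬ (T D₀ a (blocksStr σ ++ encZ K fun j => toZ x ⬝ᵥ σ j) = true) := by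
      refine Finset.filter_congr fun σ _ => ?_; simp
    rw [h']
    exact_mod_cast h

/-- The ideal count of the math layer is `Id` (sign `0`) or its complement (sign `1`). [folklore] -/
theorem card_ideal_sgn (sgn : Bool) :
    ((univ.filter fun q : Unit × Unit × (Fin K → BVec n) × BVec K × List.Vector Bool 0 =>
        Df D₀ a K sgn q.1 q.2.1 q.2.2.1 q.2.2.2.1 q.2.2.2.2).card : ℝ) =
      if sgn then (Fintype.card ((Fin K → BVec n) × BVec K) : ℝ) - Id D₀ a K (n := n) else Id D₀ a K (n := n) := by
  classical
  have hidx : ∀ P : (Fin K → BVec n) × BVec K → Prop, ∀ [DecidablePred P],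
      (univ.filter fun q : Unit × Unit × (Fin K → BVec n) × BVec K × List.Vector Bool 0 => P (q.2.2.1, q.2.2.2.1)).card =
        (univ.filter P).card := by
    intro P _
    refine Finset.card_equiv ((Equiv.punitProd _).trans ((Equiv.punitProd _).trans
      ((Equiv.prodCongr (Equiv.refl _) (Equiv.prodUnique _ _))))) fun q => ?_
    obtain ⟨_, _, σ, u, c⟩ := q
    simp [Equiv.punitProd, Equiv.prodUnique]
  simp only [Df_eq]
  rw [hidx fun q => Bool.xor sgn (T D₀ a (blocksStr q.1 ++ encZ K q.2)) = true]
  cases sgn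
  · simp [Id]
  · simp only [Bool.true_xor, ite_true, Id]
    rw [eq_sub_iff_add_eq]
    have h := Finset.card_filter_add_card_filter_not (s := (univ : Finset ((Fin K → BVec n) × BVec K)))
      (fun q => T D₀ a (blocksStr q.1 ++ encZ K q.2) = true)
    rw [card_univ, add_comm] at h
    have h' : (univ.filter fun q : (Fin K → BVec n) × BVec K => (!T D₀ a (blocksStr q.1 ++ encZ K q.2)) = true) =
        univ.filter fun q : (Fin K → BVec n) × BVec K => ¬ (T D₀ a (blocksStr q.1 ++ encZ K q.2) = true) := by
      refine Finset.filter_congr fun q _ => ?_; simp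
    rw [h']
    exact_mod_cast h

/-- `|𝔽₂ⁿ|^K = 2^{Kn}`. [folklore] -/
theorem card_blocks : (Fintype.card (Fin K → BVec n) : ℝ) = 2 ^ (K * n) := by
  rw [Fintype.card_fun, Fintype.card_fin]
  simp [BVec, ZMod.card, ← pow_mul, mul_comm K n]

/-- **The gap hypothesis of the math layer from `δ`-distinguishing.** With the sign
`sgn := [Pr_z[T(DP_K(x;z))] < Pr_w[T w]]`, a test that `δ`-distinguishes `DP_K(x; ·)` from uniform
has signed gap `2^K·Re_sgn − Id_sgn ≥ δ · 2^{Kn} · 2^K` (the hypothesis `hadv` of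
`GLPred.inverter_count` with `X = R = Unit`, no coins). [Hirahara 2021 (ECCC TR21-058), Thm. 3.12
(hypothesis); Goldreich 2001, §2.5.2 (the sign of the gap)] [cite: Hirahara2021, Thm. 3.12] -/
theorem gap_ge {δ : ℝ} (hδ : δ ≤ dpAdvantage K x.toList (T D₀ a)) :
    let sgn := decide (uniformProb (K * n) {z | T D₀ a (dpGen K x.toList z) = true} < uniformProb (K * n + K) {w | T D₀ a w = true})
    δ * (Fintype.card Unit * Fintype.card Unit * Fintype.card (Fin K → BVec n) * 2 ^ K * Fintype.card (List.Vector Bool 0)) ≤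
      2 ^ K * ((univ.filter fun q : Unit × Unit × (Fin K → BVec n) × List.Vector Bool 0 =>
          Df D₀ a K sgn q.1 q.2.1 q.2.2.1 (fun j => toZ x ⬝ᵥ q.2.2.1 j) q.2.2.2).card : ℝ) -
        ((univ.filter fun q : Unit × Unit × (Fin K → BVec n) × BVec K × List.Vector Bool 0 =>
          Df D₀ a K sgn q.1 q.2.1 q.2.2.1 q.2.2.2.1 q.2.2.2.2).card : ℝ) := by
  intro sgn
  set PrR := uniformProb (K * n) {z | T D₀ a (dpGen K x.toList z) = true} with hPrR
  set PrI := uniformProb (K * n + K) {w | T D₀ a w = true} with hPrI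
  have hRe := prReal_mul_eq D₀ a x K
  have hId := prIdeal_mul_eq D₀ a K (n := n)
  rw [← hPrR] at hRe
  rw [← hPrI] at hId
  have hadv : dpAdvantage K x.toList (T D₀ a) = |PrR - PrI| := by
    simp only [dpAdvantage, List.Vector.toList_length, hPrR, hPrI, mul_comm n K]
  rw [card_real_sgn, card_ideal_sgn, Fintype.card_prod, Nat.cast_mul, card_blocks]
  simp only [Fintype.card_unit, Nat.cast_one, one_mul, card_vector, Fintype.card_bool, pow_zero, mul_one,
    Fintype.card_fun, Fintype.card_fin, ZMod.card]
  push_cast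
  have hδ' : δ ≤ |PrR - PrI| := hadv ▸ hδ
  have hpos : (0 : ℝ) ≤ 2 ^ (K * n) * 2 ^ K := by positivity
  have key : δ * (2 ^ (K * n) * 2 ^ K) ≤ |PrR - PrI| * (2 ^ (K * n) * 2 ^ K) := mul_le_mul_of_nonneg_right hδ' hpos
  by_cases hlt : PrR < PrI
  · have hs : sgn = true := by simp only [sgn, ← hPrR, ← hPrI, hlt, decide_true]
    rw [abs_of_neg (sub_neg.2 hlt)] at key
    simp only [hs, ite_true]
    have heq : (2 : ℝ) ^ K * (2 ^ (K * n) - Re D₀ a x K) - (2 ^ (K * n) * 2 ^ K - Id D₀ a K (n := n)) =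
        -(PrR - PrI) * (2 ^ (K * n) * 2 ^ K) := by
      rw [← hRe, ← hId]; ring
    rw [heq]
    exact key
  · have hs : sgn = false := by simp only [sgn, ← hPrR, ← hPrI, hlt, decide_false]
    rw [abs_of_nonneg (sub_nonneg.2 (not_lt.1 hlt))] at key
    simp only [hs, Bool.false_eq_true, ite_false]
    have heq : (2 : ℝ) ^ K * (Re D₀ a x K : ℝ) - Id D₀ a K (n := n) = (PrR - PrI) * (2 ^ (K * n) * 2 ^ K) := by
      rw [← hRe, ← hId]; ring
    rw [heq]
    exact key

end Counts

/-! ### The randomised reconstruction on strings: one run of the Goldreich–Levin decoder -/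

section Run

variable (D₀ : Set (List Bool)) (a : List Bool) (n K kk : ℕ)

/-- **One run of the randomised reconstruction for `DP_K`** (Lemma 3.11 / the remark after Thm. 3.12,
instantiated with the tree's Goldreich–Levin decoder): with coins
`c = sgn ‖ mask_J ‖ β ‖ ω' ‖ v ‖ seeds ‖ τ ‖ (unused)` (lengths `1, K, 1, Kn, K, kk·n, kk`), output Rackoff's
candidate `candStr n kk (predStr …) seeds τ` for the string predictor built from the sign-adjusted test
`w ↦ sgn ⊕ [⟨a, w⟩ ∈ D₀]` (parity set `J`, fallback coin `β`, public blocks `ω'`, bits `v`), i.e. the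
inverter of `GoldreichLevinInverter.lean` with the side information `y := hdr a`, no coins for the test,
and free parameters `K` (number of hard-core bits = the `k` of `DP_k`) and `kk` (number of seeds).
[Hirahara 2021 (ECCC TR21-058), Lemma 3.11, Thm. 3.12 (remark); Goldreich 2001, Thm. 2.5.6 (proof, §2.5.3);
Arora–Barak 2009, Thm. 9.12] [cite: Hirahara2021, Lemma 3.11] -/
def run (c : List Bool) : List Bool :=
  let c1 := c.drop 1
  let c2 := c1.drop K
  let c3 := c2.drop 1
  let c4 := c3.drop (K * n)
  let c5 := c4.drop K
  let c6 := c5.drop (kk * n)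
  candStr n kk (predStr (testAlg D₀) n K ((c.take 1).headD false) (CondParams.fitLen (c1.take K) K) ((c2.take 1).headD false)
      (CondParams.fitLen (c3.take (K * n)) (K * n)) (CondParams.fitLen (c4.take K) K) [] (hdr a))
    (CondParams.fitLen (c5.take (kk * n)) (kk * n)) (CondParams.fitLen (c6.take kk) kk)

variable {D₀ a n K kk}

/-- **The run on split coins.** [folklore] -/
theorem run_split (s : List.Vector Bool 1) (mJ : List.Vector Bool K) (β : List.Vector Bool 1)
    (ω' : List.Vector Bool (K * n)) (v : List.Vector Bool K) (S : List.Vector Bool (kk * n)) (τ : List.Vector Bool kk) (w : List Bool) :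
    run D₀ a n K kk (s.toList ++ (mJ.toList ++ (β.toList ++ (ω'.toList ++ (v.toList ++ (S.toList ++ (τ.toList ++ w))))))) =
      candStr n kk (predStr (testAlg D₀) n K s.head mJ.toList β.head ω'.toList v.toList [] (hdr a)) S.toList τ.toList := by
  simp only [run]
  simp only [List.take_left' (List.Vector.toList_length _), List.drop_left' (List.Vector.toList_length _),
    CondParams.fitLen_of_length_eq (List.Vector.toList_length _), GLInv.headD_toList_one]

variable (D₀ a n K kk)

/-- **The number of successful coin strings** of one run (target `x`), over coins of length
`1 + K + 1 + Kn + K + kk·n + kk + W`, is at least `2^W` times the success count of the math layer for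
either sign. [folklore] -/
theorem card_success_ge (x : List.Vector Bool n) (sgn : Bool) (W : ℕ) :
    2 ^ W * (univ.filter fun t : GLPred.Coins n K (List.Vector Bool 0) × (Fin kk → BVec n) × (Fin kk → ZMod 2) =>
        glCandidate (fun r => GLPred.predB (DfS (testAlg D₀) n K sgn (hdr a)) t.1 r) kk t.2.1 t.2.2 = toZ x).card ≤
      (univ.filter fun coins : List.Vector Bool (1 + (K + (1 + (K * n + (K + (kk * n + (kk + W))))))) =>
        run D₀ a n K kk coins.toList = x.toList).card := by
  classical
  set I : List Bool → ℕ := fun l => if run D₀ a n K kk l = x.toList then 1 else 0 with hI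
  rw [Finset.card_filter (fun coins : List.Vector Bool (1 + (K + (1 + (K * n + (K + (kk * n + (kk + W))))))) =>
    run D₀ a n K kk coins.toList = x.toList)]
  change _ ≤ ∑ coins : List.Vector Bool (1 + (K + (1 + (K * n + (K + (kk * n + (kk + W))))))), I coins.toList
  -- peel the sign bit and keep `sgn`
  have h1 := Literature.Computability.Cryptography.sum_vector_add (M := ℕ) 1 (K + (1 + (K * n + (K + (kk * n + (kk + W))))))
    (fun u w => I (u ++ w))
  simp only [List.take_append_drop] at h1
  rw [h1]
  refine le_trans ?_ (Finset.single_le_sum (fun s _ => Nat.zero_le _) (Finset.mem_univ (GLInv.sgnVec sgn)))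
  rw [GLInv.toList_sgnVec]
  -- peel the other fields
  have h2 := Literature.Computability.Cryptography.sum_vector_add (M := ℕ) K (1 + (K * n + (K + (kk * n + (kk + W)))))
    (fun u w => I ([sgn] ++ (u ++ w)))
  have h3 : ∀ mJ : List Bool, ∑ r : List.Vector Bool (1 + (K * n + (K + (kk * n + (kk + W))))), I ([sgn] ++ (mJ ++ r.toList)) =
      ∑ β : List.Vector Bool 1, ∑ r : List.Vector Bool (K * n + (K + (kk * n + (kk + W)))), I ([sgn] ++ (mJ ++ (β.toList ++ r.toList))) :=
    fun mJ => by
      have h := Literature.Computability.Cryptography.sum_vector_add (M := ℕ) 1 (K * n + (K + (kk * n + (kk + W))))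
        (fun u w => I ([sgn] ++ (mJ ++ (u ++ w))))
      simpa only [List.take_append_drop] using h
  have h4 : ∀ p : List Bool, ∑ r : List.Vector Bool (K * n + (K + (kk * n + (kk + W)))), I (p ++ r.toList) =
      ∑ ω' : List.Vector Bool (K * n), ∑ r : List.Vector Bool (K + (kk * n + (kk + W))), I (p ++ (ω'.toList ++ r.toList)) :=
    fun p => by
      have h := Literature.Computability.Cryptography.sum_vector_add (M := ℕ) (K * n) (K + (kk * n + (kk + W))) (fun u w => I (p ++ (u ++ w)))
      simpa only [List.take_append_drop] using h
  have h5 : ∀ p : List Bool, ∑ r : List.Vector Bool (K + (kk * n + (kk + W))), I (p ++ r.toList) =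
      ∑ v : List.Vector Bool K, ∑ r : List.Vector Bool (kk * n + (kk + W)), I (p ++ (v.toList ++ r.toList)) :=
    fun p => by
      have h := Literature.Computability.Cryptography.sum_vector_add (M := ℕ) K (kk * n + (kk + W)) (fun u w => I (p ++ (u ++ w)))
      simpa only [List.take_append_drop] using h
  have h7 : ∀ p : List Bool, ∑ r : List.Vector Bool (kk * n + (kk + W)), I (p ++ r.toList) =
      ∑ S : List.Vector Bool (kk * n), ∑ r : List.Vector Bool (kk + W), I (p ++ (S.toList ++ r.toList)) :=
    fun p => by
      have h := Literature.Computability.Cryptography.sum_vector_add (M := ℕ) (kk * n) (kk + W) (fun u w => I (p ++ (u ++ w)))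
      simpa only [List.take_append_drop] using h
  have h8 : ∀ p : List Bool, ∑ r : List.Vector Bool (kk + W), I (p ++ r.toList) =
      ∑ τ : List.Vector Bool kk, ∑ w : List.Vector Bool W, I (p ++ (τ.toList ++ w.toList)) :=
    fun p => by
      have h := Literature.Computability.Cryptography.sum_vector_add (M := ℕ) kk W (fun u w => I (p ++ (u ++ w)))
      simpa only [List.take_append_drop] using h
  simp only [List.take_append_drop] at h2
  rw [h2]
  simp only [h3]
  simp only [← List.append_assoc] at h4 h5 h7 h8 ⊢
  simp only [h4, h5, h7, h8]
  -- the innermost summand: the run on split coins, independent of `w`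
  have hrun : ∀ (mJ : List.Vector Bool K) (β : List.Vector Bool 1) (ω' : List.Vector Bool (K * n)) (v : List.Vector Bool K)
      (S : List.Vector Bool (kk * n)) (τ : List.Vector Bool kk) (w : List.Vector Bool W),
      I ([sgn] ++ mJ.toList ++ β.toList ++ ω'.toList ++ v.toList ++ S.toList ++ τ.toList ++ w.toList) =
        if candStr n kk (predStr (testAlg D₀) n K sgn mJ.toList β.head ω'.toList v.toList [] (hdr a)) S.toList τ.toList = x.toList
        then 1 else 0 := by
    intro mJ β ω' v S τ w
    simp only [hI, List.append_assoc]
    rw [← GLInv.toList_sgnVec, run_split (GLInv.sgnVec sgn) mJ β ω' v S τ w.toList]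
    rfl
  simp only [hrun, Finset.sum_const, Finset.card_univ, card_vector, Fintype.card_bool, smul_eq_mul]
  -- re-index the fields by the objects of the math layer
  rw [Finset.card_filter, Finset.mul_sum,
    show (∑ mJ : List.Vector Bool K, ∑ β : List.Vector Bool 1, ∑ ω' : List.Vector Bool (K * n), ∑ v : List.Vector Bool K,
        ∑ S : List.Vector Bool (kk * n), ∑ τ : List.Vector Bool kk,
          2 ^ W * (if candStr n kk (predStr (testAlg D₀) n K sgn mJ.toList β.head ω'.toList v.toList [] (hdr a)) S.toList τ.toList = x.toList
            then 1 else 0)) =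
      ∑ q : (List.Vector Bool K × (List.Vector Bool 1 × (List.Vector Bool (K * n) × (List.Vector Bool K × List.Vector Bool 0)))) ×
          (List.Vector Bool (kk * n) × List.Vector Bool kk),
        2 ^ W * (if candStr n kk (predStr (testAlg D₀) n K sgn q.1.1.toList q.1.2.1.head q.1.2.2.1.toList q.1.2.2.2.1.toList
          q.1.2.2.2.2.toList (hdr a)) q.2.1.toList q.2.2.toList = x.toList then 1 else 0) by
      simp only [Fintype.sum_prod_type]
      refine Finset.sum_congr rfl fun mJ _ => Finset.sum_congr rfl fun β _ => Finset.sum_congr rfl fun ω' _ =>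
        Finset.sum_congr rfl fun v _ => ?_
      exact (Fintype.sum_unique (ι := List.Vector Bool 0) (M := ℕ) fun cD => ∑ S : List.Vector Bool (kk * n), ∑ τ : List.Vector Bool kk,
        2 ^ W * (if candStr n kk (predStr (testAlg D₀) n K sgn mJ.toList β.head ω'.toList v.toList cD.toList (hdr a)) S.toList τ.toList = x.toList
          then 1 else 0)).symm]
  refine (Fintype.sum_equiv (GLInv.fieldEquiv n K kk 0) _ _ fun q => ?_).ge
  obtain ⟨⟨mJ, β, ω', v, cD⟩, S, τ⟩ := q
  rw [GLInv.fieldEquiv_apply]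
  dsimp only
  rw [GLInv.toList_eq_blocksStr_symm ω', GLInv.toList_eq_blocksStr_symm S, ← encZ_toZ v, ← encZ_toZ τ]
  congr 1
  exact if_congr (GLInv.indicator_iff x (hdr a) sgn mJ β _ _ cD _ _) rfl rfl

/-- **The success probability of one run.** If the test `w ↦ [⟨a, w⟩ ∈ D₀]` `δ`-distinguishes
`DP_K(x; ·)` from uniform (`δ > 0`) and the number of seeds satisfies `n ≤ 2(δ/2^{K+1})²(2^kk − 1)`,
then one run outputs `x` with probability `≥ δ/(4·2^K·2^kk)` over coins of any length
`≥ 1 + K + 1 + Kn + K + kk·n + kk` (the extra `W` coins are unused): the XOR lemma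
(`GLPred.card_agree_ge`), Goldreich–Levin decoding (`goldreich_levin_cand`) and a uniformly random
guess of the `kk` bits (`GLPred.inverter_count`), the sign costing a factor `2`.
[Hirahara 2021 (ECCC TR21-058), Lemma 3.11 ("outputs `x` with probability at least `1/poly(n/ε)`");
Goldreich 2001, Thm. 2.5.6; Arora–Barak 2009, Thm. 9.12] [cite: Hirahara2021, Lemma 3.11] -/
theorem uniformProb_run_eq_ge (x : List.Vector Bool n) {δ : ℝ} (hδ : 0 < δ) (hadv : δ ≤ dpAdvantage K x.toList (T D₀ a))
    (hk : 0 < kk) (hm : (n : ℝ) ≤ 2 * (δ / 2 ^ K / 2) ^ 2 * (2 ^ kk - 1 : ℕ)) (W : ℕ) :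
    δ / (4 * 2 ^ K * 2 ^ kk) ≤
      uniformProb (1 + (K + (1 + (K * n + (K + (kk * n + (kk + W))))))) {c | run D₀ a n K kk c = x.toList} := by
  classical
  set C := 1 + (K + (1 + (K * n + (K + (kk * n + (kk + W)))))) with hCdef
  set sgn : Bool := decide (uniformProb (K * n) {z | T D₀ a (dpGen K x.toList z) = true} <
    uniformProb (K * n + K) {w | T D₀ a w = true}) with hsgn
  -- the math layer
  have hcount := GLPred.inverter_count (X := Unit) (R := Unit) (C := List.Vector Bool 0)
    (Df D₀ a K sgn) (fun _ => toZ x) hδ (gap_ge D₀ a x K hadv) hk hm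
  -- the string layer
  have hstr := card_success_ge D₀ a n K kk x sgn W
  have hstr' : (2 : ℝ) ^ W * ((univ.filter fun t : GLPred.Coins n K (List.Vector Bool 0) × (Fin kk → BVec n) × (Fin kk → ZMod 2) =>
      glCandidate (fun r => GLPred.predB (DfS (testAlg D₀) n K sgn (hdr a)) t.1 r) kk t.2.1 t.2.2 = toZ x).card : ℝ) ≤
      ((univ.filter fun coins : List.Vector Bool C => run D₀ a n K kk coins.toList = x.toList).card : ℝ) := by
    exact_mod_cast hstr
  -- the count of the math layer, re-indexed to drop the `Unit` factors
  have hreidx : ((univ.filter fun t : (Unit × Unit × GLPred.Coins n K (List.Vector Bool 0)) × (Fin kk → BVec n) × (Fin kk → ZMod 2) =>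
        glCandidate (fun r => GLPred.predB (Df D₀ a K sgn t.1.1 t.1.2.1) t.1.2.2 r) kk t.2.1 t.2.2 = toZ x).card : ℝ) =
      ((univ.filter fun t : GLPred.Coins n K (List.Vector Bool 0) × (Fin kk → BVec n) × (Fin kk → ZMod 2) =>
        glCandidate (fun r => GLPred.predB (DfS (testAlg D₀) n K sgn (hdr a)) t.1 r) kk t.2.1 t.2.2 = toZ x).card : ℝ) := by
    congr 1
    refine Finset.card_equiv (Equiv.prodCongr ((Equiv.punitProd _).trans (Equiv.punitProd _)) (Equiv.refl _)) fun t => ?_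
    simp only [mem_filter, mem_univ, true_and]
    exact Iff.rfl
  have htot : (Fintype.card ((Unit × Unit × GLPred.Coins n K (List.Vector Bool 0)) × (Fin kk → BVec n) × (Fin kk → ZMod 2)) : ℝ) =
      2 ^ K * (2 * (2 ^ (K * n) * (2 ^ K * 1))) * 2 ^ (kk * n) * 2 ^ kk := by
    rw [Fintype.card_prod, Fintype.card_prod, Fintype.card_prod, GLPred.card_Coins, Fintype.card_prod]
    simp only [Fintype.card_unit, card_vector, Fintype.card_bool, Fintype.card_fun, Fintype.card_fin, ZMod.card, pow_zero]
    push_cast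
    simp [← pow_mul, mul_comm K n, mul_comm kk n]
    ring
  rw [htot, hreidx] at hcount
  -- arithmetic
  unfold uniformProb
  rw [le_div_iff₀ (by positivity)]
  refine le_trans ?_ (hstr'.trans (le_of_eq (by congr 2; ext r; simp)))
  have hC2 : (2 : ℝ) ^ C = 2 * 2 ^ K * 2 * 2 ^ (K * n) * 2 ^ K * 2 ^ (kk * n) * 2 ^ kk * 2 ^ W := by
    rw [hCdef]; simp only [pow_add, pow_one]; ring
  rw [hC2]
  have h2K : (0 : ℝ) < 2 ^ K := by positivity
  have h2k : (0 : ℝ) < 2 ^ kk := by positivity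
  calc δ / (4 * 2 ^ K * 2 ^ kk) * (2 * 2 ^ K * 2 * 2 ^ (K * n) * 2 ^ K * 2 ^ (kk * n) * 2 ^ kk * 2 ^ W)
      = 2 ^ W * (δ / 2 ^ K / 2 / 2 ^ kk * (2 ^ K * (2 * (2 ^ (K * n) * (2 ^ K * 1))) * 2 ^ (kk * n) * 2 ^ kk)) := by
        field_simp
        ring
    _ ≤ _ := mul_le_mul_of_nonneg_left hcount (by positivity)

end Run

end DPRecon

end Literature.Computability.MetaComplexity

end
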